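import Summits.QuantumFields.YangMills.Theorems.UnitScaleTiltProp7AvgTrueLinearisationDiff
import Summits.QuantumFields.YangMills.Theorems.UnitScaleTiltProp7FibreTrueLinDefectMass
import Literature.MathematicalPhysics.QuantumFieldTheory.Balaban1983to89.B7Prop1Explicit
import HarnessLib

/-!
# Route `UnitScaleTilt`, crux K1 «MinimiserStabilityRegPr» (stmt-QuantumFields-19200), route-R (n3) JOINT row mod coarse gauge, file F3 of the namer's cut
# (★p1 g14 2026-08-28 15:11Z) — THE ONE-STEP LOG-REMAINDER IN CRUDE MASS² CURRENCY:
# `‖X_{j+1}(c) − T_jX_j(c)‖ ≤ 772·m_j(c)²`, `Σ_c‖X_{j+1}(c) − T_jX_j(c)‖ ≤ 772·((d+2)L)²·(2dL^d)·(2d)·Σ_b‖Y_j(b)‖²`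

Cell `ym3-torus`, D-0154 (3c) twin-width seat `ym-routeR-w3` (gen 5).  THEOREMS ONLY (0 `def`, 0 `sorry`); `--supports stmt-QuantumFields-19200`, count-neutral.
YM₃ on T³ is a ladder rung (R3), not the Clay problem; nothing here claims the stub, the crux, d = 4 or the mass gap.

THE POINT.  File 2c ✓ `…Prop7FibreLogRatioL1` (and its mod-gauge sequel F2) transports the `ℓ¹` norm of the true linearised constraint down the (0.4) tower in
LOG currency: with the level ratios `Y_j = pertVar Ū₀^{(j)} W̄^{(j)}` and the log-ratio fields `X_j = mlog (Y_j + 1)`, the only analytic input left displayed is the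
per-level SOURCE row `Σ_c‖X_{j+1}(c) − T_jX_j(c)‖` of the one-step log-remainder (`T_j` = the true one-step derivative of ★p1 g4's ✓ `…Prop7AvgTrueLinearisation`,
the `hQs` letters).  The namer's conserved-current shortcut (★p1 g14) needs this row in CRUDE mass² currency only — no commutator structure, no local pairing,
no oscillation.  This file supplies exactly that, per coarse bond and summed:
`X_{j+1}(c) − T_jX_j(c) = [mlog(1+R) − R] + [R − T_jY_j(c)] + T_j[Y_j − X_j](c)` with `R = Y_{j+1}(c)` the one-step ratio; the middle bracket is ✓
`norm_avgFun_ratio_sub_one_sub_trueLin_le` (`≤ 260m²`), the two log brackets are the universal second-order letter ✓ `B7Prop1Explicit.norm_mlog_sub_le`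
(`‖mlog W − (W − 1)‖ ≤ ρ(2‖W − 1‖)`, `ρ(t) = eᵗ − 1 − t ≤ t²`), carried through `T_j` by its walk-mass bound `‖T_jZ(c)‖ ≤ 7·(walk mass of Z)` (✓ `norm_covWalkSum_le_mass`,
✓ `norm_fderiv_eml_apply_le`).  Reading the walk masses in the two-block neighbourhood `N(c)` (✓ `mass_loop_le`, ✓ `mass_segment_le`) and summing with the
two-block Cauchy–Schwarz with multiplicity (✓ `sum_sq_nbhdMass_le`) gives the `ℓ¹` row against the `ℓ²` MASS `Σ_b‖Y_j b‖²` of the level ratio — the `M_l` of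
✓ `…Prop7FibreLevelMass`, so F4 ✓∕⧗ `…Prop7JointRowOfLevelMasses` reads it with no conversion (`hr : r l ≤ C·M l`, `C = 772·((d+2)L)²·(2dL^d)·(2d)`).

WHAT IS PROVED (ns `…Theorems.Prop7LogRemainderMass`; `SU(n)`, any `P`, any level `j`).
* §0 `norm_mlog_add_one_sub_le` (`‖mlog (Y + 1) − Y‖ ≤ 4‖Y‖²` for `‖Y‖ ≤ ½`), `list_sum_map_le_of_forall_le`-type bookkeeping.
* §1 `norm_trueLin_le_of_mass` — `‖T_VZ(c)‖ ≤ 7·m` when the (0.4) walk masses of `Z` at `c` are `≤ m` and the background loop variables are within `1∕24` of `1`;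
  `trueLin_sub` — `T_V` is additive (`T_VZ − T_VZ′ = T_V(Z − Z′)`).
* §2 ★★★ `norm_mlog_pertVar_avg_sub_trueLin_mlog_le` — per coarse bond: `‖X_{j+1}(c) − T_jX_j(c)‖ ≤ 772·m²` under the walk-mass guard `72m ≤ 1`, `α ≤ 1∕24`, `3m + α < δ_N`.
* §3 ★★★ `sum_norm_logRemainder_le_mass` — at level `j` of the towers of `U₀`, `W` (2c's letters VERBATIM): `Σ_c‖X_{j+1}(c) − T_jX_j(c)‖ ≤ 772·((d+2)L)²·(2dL^d)·(2d)·Σ_b‖Y_j b‖²`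
  under ONE sup guard `(d+2)L·Σ_{b∈N(c)}‖Y_j b‖ ≤ μ`, `72μ ≤ 1`, `3μ + a_j < δ_N`, `a_j ≤ 1∕24`.
HONEST SCOPE.  Bookkeeping over the cited tree theorems; the smallness of the level ratios (`μ`) and of the background loop variables (`a_j`) stay DISPLAYED
(suppliers: the tower sup rows of the lane).  Nothing of [Balaban1985Averaging] is asserted beyond the tree.

References: T. Bałaban, CMP 98 (1985) 17–51 [Balaban1985Averaging] ((26)–(27) p.21, Prop. 3 (122)–(126) p.36); CMP 109 (1987) 249–301 [Balaban1987RG1] ((0.3)–(0.4) pp.252–253);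
CMP 102 (1985) 277–309 [Balaban1985Variational] ((15) p.280, Prop. 7 p.299).
-/

set_option autoImplicit false

noncomputable section

open scoped BigOperators Matrix.Norms.L2Operator

namespace Summit.QuantumFields.YangMills.Theorems.Prop7LogRemainderMass

open Literature.MathematicalPhysics.QuantumFieldTheory.Balaban1983to89
open Finset T4Continuum BlockAveraging AveragingRT ExpMeanLog LatticeWordStokes B7TransferAnalyticMean BlockAveragingEMLAnalyticMean
open BlockAveragingEMLLinearised BlockAveragingEMLLinearisedBackground BlockAveragingEMLProp2
open MatrixLog (mlog)
open B7Prop1Explicit (expRem expRem_le_sq expRem_mono expRem_nonneg)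
open Summit.QuantumFields.YangMills.Theorems.Prop7HolRatioPerStep (norm_avgFun_ratio_sub_one_sub_trueLin_le norm_covWalkSum_le_mass pi_norm_le_of_forall
  norm_coe_eq_one norm_star_coe_eq_one list_sum_sq_le_sq_sum)
open Summit.QuantumFields.YangMills.Theorems.Prop7TrueLinDefectBound (mass_loop_le mass_segment_le card_nbhd_le sum_nbhd_le)
open Summit.QuantumFields.YangMills.Theorems.Prop7FibreTrueLinDefectMass (sum_sq_nbhdMass_le)

variable {n : Type*} [Fintype n] [DecidableEq n] [Nonempty n] {P : Params} {j : ℕ}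

/-! ## §0 The logarithm to second order, and list bookkeeping -/

omit [Nonempty n] in
/-- **`‖mlog (Y + 1) − Y‖ ≤ 4‖Y‖²` for `‖Y‖ ≤ ½`** — the universal second-order letter of the logarithm (`ρ(2‖Y‖) ≤ (2‖Y‖)²`). [cite: Balaban1985Averaging, (26)-(27) p.21] -/
theorem norm_mlog_add_one_sub_le {Y : Matrix n n ℂ} (hY : ‖Y‖ ≤ 1 / 2) : ‖mlog (Y + 1) - Y‖ ≤ 4 * ‖Y‖ ^ 2 := by
  have h := B7Prop1Explicit.norm_mlog_sub_le (𝔸 := Matrix n n ℂ) (W := Y + 1) (by simpa using hY)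
  have h1 : Y + 1 - 1 = Y := by abel
  rw [h1] at h
  calc ‖mlog (Y + 1) - Y‖ ≤ expRem (2 * ‖Y‖) := h
    _ ≤ (2 * ‖Y‖) ^ 2 := expRem_le_sq (by positivity) (by linarith)
    _ = 4 * ‖Y‖ ^ 2 := by ring

/-- List bookkeeping: a termwise bound passes to the mapped sum. [folklore] -/
theorem list_sum_map_le_sum_map {ι : Type*} (l : List ι) (f g : ι → ℝ) (h : ∀ x ∈ l, f x ≤ g x) : (l.map f).sum ≤ (l.map g).sum := by
  induction l with
  | nil => simp
  | cons x l ih =>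
    simp only [List.map_cons, List.sum_cons]
    exact add_le_add (h x (by simp)) (ih fun y hy => h y (by simp [hy]))

/-- List bookkeeping: every term of a nonnegative mapped sum is bounded by the sum. [folklore] -/
theorem le_list_sum_map_of_mem {ι : Type*} (l : List ι) (f : ι → ℝ) (hf : ∀ x, 0 ≤ f x) {x : ι} (hx : x ∈ l) : f x ≤ (l.map f).sum := by
  induction l with
  | nil => simp at hx
  | cons y l ih =>
    simp only [List.map_cons, List.sum_cons]
    have h0 : 0 ≤ (l.map f).sum := List.sum_nonneg fun z hz => by obtain ⟨w, _, rfl⟩ := List.mem_map.mp hz; exact hf w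
    rcases List.mem_cons.mp hx with rfl | hx'
    · linarith
    · linarith [ih hx', hf y]


/-- Scalar∕normed-group bookkeeping of §2: `‖X⁺ − T X‖ ≤ 772m²` from the three pieces. [folklore] -/
theorem norm_sub_le_of_three_pieces {E : Type*} [SeminormedAddCommGroup E] (Xp R TX TY TXY : E) {m : ℝ} (hm0 : 0 ≤ m) (hm72 : 72 * m ≤ 1)
    (hRT : ‖R - TY‖ ≤ 260 * m ^ 2) (hTY : ‖TY‖ ≤ 7 * m) (hlog : ‖R‖ ≤ 1 / 2 → ‖Xp - R‖ ≤ 4 * ‖R‖ ^ 2) (hTXY : ‖TXY‖ ≤ 7 * (4 * m ^ 2))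
    (hsplit : TX - TY = TXY) : ‖Xp - TX‖ ≤ 772 * m ^ 2 := by
  have hm1 : m ≤ 1 / 72 := by linarith
  have hR : ‖R‖ ≤ 11 * m := by
    have h1 : ‖R‖ ≤ ‖R - TY‖ + ‖TY‖ := norm_le_norm_sub_add R TY
    have h2 : 260 * m ^ 2 ≤ 4 * m := by nlinarith
    linarith
  have hRhalf : ‖R‖ ≤ 1 / 2 := hR.trans (by linarith)
  have hlogR : ‖Xp - R‖ ≤ 484 * m ^ 2 := by
    calc ‖Xp - R‖ ≤ 4 * ‖R‖ ^ 2 := hlog hRhalf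
      _ ≤ 4 * (11 * m) ^ 2 := by gcongr
      _ = 484 * m ^ 2 := by ring
  have e : Xp - TX = (Xp - R) + (R - TY) - (TX - TY) := by abel
  rw [e, hsplit]
  calc ‖(Xp - R) + (R - TY) - TXY‖ ≤ ‖(Xp - R) + (R - TY)‖ + ‖TXY‖ := norm_sub_le _ _
    _ ≤ (484 * m ^ 2 + 260 * m ^ 2) + 7 * (4 * m ^ 2) := add_le_add ((norm_add_le _ _).trans (add_le_add hlogR hRT)) hTXY
    _ = 772 * m ^ 2 := by ring

omit [Nonempty n] in
/-- The log letter along a walk: if `Σ_{s∈l}‖Y_{b(s)}‖ ≤ m ≤ ½` then `Σ_{s∈l}‖(mlog (Y + 1) − Y)_{b(s)}‖ ≤ 4m²`. [cite: Balaban1985Averaging, (26)-(27) p.21] -/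
theorem walk_mass_mlog_sub_le (Y : PBond P j → Matrix n n ℂ) (l : List (LStep P j)) {m : ℝ}
    (hl : (l.map fun s => ‖Y s.bond‖).sum ≤ m) (hm : m ≤ 1 / 2) :
    (l.map fun s => ‖((fun b => mlog (Y b + 1)) - Y) s.bond‖).sum ≤ 4 * m ^ 2 := by
  have h0 : 0 ≤ (l.map fun s => ‖Y s.bond‖).sum := List.sum_nonneg fun y hy => by obtain ⟨z, _, rfl⟩ := List.mem_map.mp hy; exact norm_nonneg _
  have hb : ∀ s ∈ l, ‖Y s.bond‖ ≤ m := fun s hs => (le_list_sum_map_of_mem l (fun s => ‖Y s.bond‖) (fun _ => norm_nonneg _) hs).trans hl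
  have h1 : (l.map fun s => ‖Y s.bond‖ ^ 2).sum ≤ (l.map fun s => ‖Y s.bond‖).sum ^ 2 :=
    list_sum_sq_le_sq_sum (fun s : LStep P j => ‖Y s.bond‖) (fun _ => norm_nonneg _) l
  have h2 : (l.map fun s => ‖Y s.bond‖).sum ^ 2 ≤ m ^ 2 := pow_le_pow_left₀ h0 hl 2
  have hsq : (l.map fun s => ‖Y s.bond‖ ^ 2).sum ≤ m ^ 2 := h1.trans h2
  calc (l.map fun s => ‖((fun b => mlog (Y b + 1)) - Y) s.bond‖).sum ≤ (l.map fun s => 4 * ‖Y s.bond‖ ^ 2).sum := by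
        refine list_sum_map_le_sum_map l _ _ fun s hs => ?_
        have h := norm_mlog_add_one_sub_le ((hb s hs).trans hm)
        simpa only [Pi.sub_apply] using h
    _ = 4 * (l.map fun s => ‖Y s.bond‖ ^ 2).sum := by rw [List.sum_map_mul_left]
    _ ≤ 4 * m ^ 2 := by linarith

/-! ## §1 The true one-step derivative `T_V`: walk-mass bound and additivity -/

omit [Nonempty n] in
/-- `covWalkSum` is subtractive in the bond field (from ✓ `covWalkSum_add`, ✓ `covWalkSum_smul`). [cite: Balaban1985Averaging, (122) p.36] -/
theorem covWalkSum_sub (V : GaugeField P j (Matrix.specialUnitaryGroup n ℂ)) (Z Z' : PBond P j → Matrix n n ℂ) (γ : List (LStep P j)) :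
    covWalkSum V (Z - Z') γ = covWalkSum V Z γ - covWalkSum V Z' γ := by
  have h : Z - Z' = Z + (-1 : ℂ) • Z' := by ext b i k; simp [sub_eq_add_neg]
  rw [h, covWalkSum_add, covWalkSum_smul]
  simp [sub_eq_add_neg]

/-- **`T_V` IS ADDITIVE**: `T_VZ(c) − T_VZ′(c) = T_V(Z − Z′)(c)` — the true one-step derivative is linear in the bond field (`covWalkSum` linear,
`D eml(W₀)` a continuous linear map). [cite: Balaban1985Averaging, Prop. 3 (122)-(124) p.36] -/
theorem trueLin_sub (V : GaugeField P j (Matrix.specialUnitaryGroup n ℂ)) (Z Z' : PBond P j → Matrix n n ℂ) (c : PBond P (j + 1)) :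
    (fderiv ℂ (eml : (Idx P → Matrix n n ℂ) → Matrix n n ℂ) (fun i => ((loopHol V c i : Matrix.specialUnitaryGroup n ℂ) : Matrix n n ℂ))
          (fun i => covWalkSum V Z (walk (emb c.src) (loopWord P.L c.dir (off i.1) i.2.1 i.2.2)) * ((loopHol V c i : Matrix.specialUnitaryGroup n ℂ) : Matrix n n ℂ))
          * star ((corr (expMeanLogSU (n := n)) V c : Matrix.specialUnitaryGroup n ℂ) : Matrix n n ℂ)
        + ((corr (expMeanLogSU (n := n)) V c : Matrix.specialUnitaryGroup n ℂ) : Matrix n n ℂ)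
          * covWalkSum V Z (walk (emb c.src) (List.replicate P.L (c.dir, true)))
          * star ((corr (expMeanLogSU (n := n)) V c : Matrix.specialUnitaryGroup n ℂ) : Matrix n n ℂ))
      - (fderiv ℂ (eml : (Idx P → Matrix n n ℂ) → Matrix n n ℂ) (fun i => ((loopHol V c i : Matrix.specialUnitaryGroup n ℂ) : Matrix n n ℂ))
          (fun i => covWalkSum V Z' (walk (emb c.src) (loopWord P.L c.dir (off i.1) i.2.1 i.2.2)) * ((loopHol V c i : Matrix.specialUnitaryGroup n ℂ) : Matrix n n ℂ))
          * star ((corr (expMeanLogSU (n := n)) V c : Matrix.specialUnitaryGroup n ℂ) : Matrix n n ℂ)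
        + ((corr (expMeanLogSU (n := n)) V c : Matrix.specialUnitaryGroup n ℂ) : Matrix n n ℂ)
          * covWalkSum V Z' (walk (emb c.src) (List.replicate P.L (c.dir, true)))
          * star ((corr (expMeanLogSU (n := n)) V c : Matrix.specialUnitaryGroup n ℂ) : Matrix n n ℂ))
      = fderiv ℂ (eml : (Idx P → Matrix n n ℂ) → Matrix n n ℂ) (fun i => ((loopHol V c i : Matrix.specialUnitaryGroup n ℂ) : Matrix n n ℂ))
          (fun i => covWalkSum V (Z - Z') (walk (emb c.src) (loopWord P.L c.dir (off i.1) i.2.1 i.2.2)) * ((loopHol V c i : Matrix.specialUnitaryGroup n ℂ) : Matrix n n ℂ))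
          * star ((corr (expMeanLogSU (n := n)) V c : Matrix.specialUnitaryGroup n ℂ) : Matrix n n ℂ)
        + ((corr (expMeanLogSU (n := n)) V c : Matrix.specialUnitaryGroup n ℂ) : Matrix n n ℂ)
          * covWalkSum V (Z - Z') (walk (emb c.src) (List.replicate P.L (c.dir, true)))
          * star ((corr (expMeanLogSU (n := n)) V c : Matrix.specialUnitaryGroup n ℂ) : Matrix n n ℂ) := by
  have htuple : (fun i : Idx P => covWalkSum V (Z - Z') (walk (emb c.src) (loopWord P.L c.dir (off i.1) i.2.1 i.2.2)) * ((loopHol V c i : Matrix.specialUnitaryGroup n ℂ) : Matrix n n ℂ))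
      = (fun i : Idx P => covWalkSum V Z (walk (emb c.src) (loopWord P.L c.dir (off i.1) i.2.1 i.2.2)) * ((loopHol V c i : Matrix.specialUnitaryGroup n ℂ) : Matrix n n ℂ))
        - (fun i : Idx P => covWalkSum V Z' (walk (emb c.src) (loopWord P.L c.dir (off i.1) i.2.1 i.2.2)) * ((loopHol V c i : Matrix.specialUnitaryGroup n ℂ) : Matrix n n ℂ)) := by
    ext i : 1
    simp only [Pi.sub_apply, covWalkSum_sub, sub_mul]
  rw [htuple, map_sub, covWalkSum_sub]
  noncomm_ring

/-- **THE TRUE ONE-STEP DERIVATIVE IS BOUNDED BY THE WALK MASSES**: if every (0.4) loop walk at `c` and the straight segment carry `ℓ¹` mass `Σ_s‖Z_{b(s)}‖ ≤ m`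
and the background's loop variables at `c` are within `α ≤ 1∕24` of `1`, then `‖T_VZ(c)‖ ≤ 7·m` (`‖D eml(W₀)‖ ≤ 6` near `1`, unitary conjugations are isometric,
`‖Z_V(Γ)‖ ≤` mass). [cite: Balaban1985Averaging, Prop. 3 (122)-(125) p.36] -/
theorem norm_trueLin_le_of_mass (V : GaugeField P j (Matrix.specialUnitaryGroup n ℂ)) (Z : PBond P j → Matrix n n ℂ) (c : PBond P (j + 1)) {m α : ℝ}
    (hmL : ∀ i : Idx P, ((walk (emb c.src) (loopWord P.L c.dir (off i.1) i.2.1 i.2.2)).map fun s => ‖Z s.bond‖).sum ≤ m)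
    (hmS : ((walk (emb c.src) (List.replicate P.L (c.dir, true))).map fun s => ‖Z s.bond‖).sum ≤ m)
    (hα : ∀ i, dist1 (loopHol V c i) ≤ α) (hα24 : α ≤ 1 / 24) :
    ‖fderiv ℂ (eml : (Idx P → Matrix n n ℂ) → Matrix n n ℂ) (fun i => ((loopHol V c i : Matrix.specialUnitaryGroup n ℂ) : Matrix n n ℂ))
          (fun i => covWalkSum V Z (walk (emb c.src) (loopWord P.L c.dir (off i.1) i.2.1 i.2.2)) * ((loopHol V c i : Matrix.specialUnitaryGroup n ℂ) : Matrix n n ℂ))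
          * star ((corr (expMeanLogSU (n := n)) V c : Matrix.specialUnitaryGroup n ℂ) : Matrix n n ℂ)
        + ((corr (expMeanLogSU (n := n)) V c : Matrix.specialUnitaryGroup n ℂ) : Matrix n n ℂ)
          * covWalkSum V Z (walk (emb c.src) (List.replicate P.L (c.dir, true)))
          * star ((corr (expMeanLogSU (n := n)) V c : Matrix.specialUnitaryGroup n ℂ) : Matrix n n ℂ)‖ ≤ 7 * m := by
  have hm0 : 0 ≤ m := (List.sum_nonneg fun y hy => by obtain ⟨z, _, rfl⟩ := List.mem_map.mp hy; exact norm_nonneg _).trans hmS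
  set W₀ : Idx P → Matrix n n ℂ := fun i => ((loopHol V c i : Matrix.specialUnitaryGroup n ℂ) : Matrix n n ℂ) with hW₀
  set κ₀ : Matrix n n ℂ := ((corr (expMeanLogSU (n := n)) V c : Matrix.specialUnitaryGroup n ℂ) : Matrix n n ℂ) with hκ₀
  set Wt : Idx P → Matrix n n ℂ := fun i => covWalkSum V Z (walk (emb c.src) (loopWord P.L c.dir (off i.1) i.2.1 i.2.2)) * W₀ i with hWt
  have hW₀1 : ∀ i, ‖W₀ i - 1‖ ≤ α := fun i => by rw [hW₀, ← FederbushMean.dist1_SU_eq]; exact hα i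
  have hW₀n : ∀ i, ‖W₀ i‖ = 1 := fun i => norm_coe_eq_one _
  have hW₀sup6 : ‖W₀ - 1‖ ≤ 1 / 6 :=
    pi_norm_le_of_forall (by norm_num) fun i => by simpa only [Pi.sub_apply, Pi.one_apply] using (hW₀1 i).trans (hα24.trans (by norm_num))
  have hWt : ‖Wt‖ ≤ m := pi_norm_le_of_forall hm0 fun i => by
    calc ‖Wt i‖ ≤ ‖covWalkSum V Z (walk (emb c.src) (loopWord P.L c.dir (off i.1) i.2.1 i.2.2))‖ * ‖W₀ i‖ := norm_mul_le _ _
      _ ≤ m * 1 := by rw [hW₀n]; exact mul_le_mul_of_nonneg_right ((norm_covWalkSum_le_mass V Z _).trans (hmL i)) zero_le_one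
      _ = m := mul_one m
  have hκ₀n : ‖κ₀‖ = 1 := norm_coe_eq_one _
  have hκ₀sn : ‖star κ₀‖ = 1 := norm_star_coe_eq_one _
  have hD : ‖fderiv ℂ (eml : (Idx P → Matrix n n ℂ) → Matrix n n ℂ) W₀ Wt‖ ≤ 6 * m :=
    (norm_fderiv_eml_apply_le hW₀sup6 _).trans (by linarith)
  have hS : ‖covWalkSum V Z (walk (emb c.src) (List.replicate P.L (c.dir, true)))‖ ≤ m := (norm_covWalkSum_le_mass V Z _).trans hmS
  calc _ ≤ ‖fderiv ℂ (eml : (Idx P → Matrix n n ℂ) → Matrix n n ℂ) W₀ Wt * star κ₀‖ + ‖κ₀ * covWalkSum V Z (walk (emb c.src) (List.replicate P.L (c.dir, true))) * star κ₀‖ :=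
        norm_add_le _ _
    _ ≤ ‖fderiv ℂ (eml : (Idx P → Matrix n n ℂ) → Matrix n n ℂ) W₀ Wt‖ * ‖star κ₀‖ + ‖κ₀‖ * ‖covWalkSum V Z (walk (emb c.src) (List.replicate P.L (c.dir, true)))‖ * ‖star κ₀‖ :=
        add_le_add (norm_mul_le _ _) ((norm_mul_le _ _).trans (mul_le_mul_of_nonneg_right (norm_mul_le _ _) (norm_nonneg _)))
    _ ≤ 6 * m * 1 + 1 * m * 1 := by
        rw [hκ₀n, hκ₀sn]
        exact add_le_add (mul_le_mul_of_nonneg_right hD zero_le_one) (by rw [one_mul, mul_one, one_mul, mul_one]; exact hS)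
    _ = 7 * m := by ring

/-! ## §2 ★★★ Per coarse bond: the one-step log-remainder is quadratic in the walk masses -/

/-- ★★★ **THE ONE-STEP LOG-REMAINDER PER COARSE BOND, QUADRATIC IN THE WALK MASSES.**  Background `V` and field `U` at level `j` (`SU(n)`), coarse bond `c`;
`Y = pertVar V U` the ratio field, `X = mlog (Y + 1)` the log-ratio field; every (0.4) loop walk at `c` and the straight segment carry `ℓ¹` mass `Σ_s‖Y_{b(s)}‖ ≤ m`
with `72m ≤ 1`; the background's loop variables at `c` are within `α ≤ 1∕24` of `1`, `3m + α < δ_n`.  Then, with `T_V` the true one-step derivative (the `hQs` letters of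
✓ `…Prop7FibreLogRatioL1`) and `X⁺(c) = mlog (pertVar V̄ Ū c + 1)` the log-ratio of the (0.4) averages:
`‖X⁺(c) − T_VX(c)‖ ≤ 772·m²` (`= [mlog(1+R) − R] + [R − T_VY(c)] − T_V(X − Y)(c)`, `R = Ū(c)V̄(c)* − 1`: `484m² + 260m² + 28m²`).
[cite: Balaban1985Averaging, Prop. 3 (122)-(126) p.36, (26)-(27) p.21] -/
theorem norm_mlog_pertVar_avg_sub_trueLin_mlog_le (V U : GaugeField P j (Matrix.specialUnitaryGroup n ℂ)) (c : PBond P (j + 1)) {m α : ℝ}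
    (hmL : ∀ i : Idx P, ((walk (emb c.src) (loopWord P.L c.dir (off i.1) i.2.1 i.2.2)).map fun s => ‖pertVar V U s.bond‖).sum ≤ m)
    (hmS : ((walk (emb c.src) (List.replicate P.L (c.dir, true))).map fun s => ‖pertVar V U s.bond‖).sum ≤ m)
    (hm72 : 72 * m ≤ 1) (hα : ∀ i, dist1 (loopHol V c i) ≤ α) (hα24 : α ≤ 1 / 24) (hN : 3 * m + α < deltaSU n) :
    ‖mlog (pertVar (avgFun (expMeanLogSU (n := n)) V) (avgFun (expMeanLogSU (n := n)) U) c + 1)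
        - (fderiv ℂ (eml : (Idx P → Matrix n n ℂ) → Matrix n n ℂ) (fun i => ((loopHol V c i : Matrix.specialUnitaryGroup n ℂ) : Matrix n n ℂ))
            (fun i => covWalkSum V (fun b => mlog (pertVar V U b + 1)) (walk (emb c.src) (loopWord P.L c.dir (off i.1) i.2.1 i.2.2)) * ((loopHol V c i : Matrix.specialUnitaryGroup n ℂ) : Matrix n n ℂ))
            * star ((corr (expMeanLogSU (n := n)) V c : Matrix.specialUnitaryGroup n ℂ) : Matrix n n ℂ)
          + ((corr (expMeanLogSU (n := n)) V c : Matrix.specialUnitaryGroup n ℂ) : Matrix n n ℂ)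
            * covWalkSum V (fun b => mlog (pertVar V U b + 1)) (walk (emb c.src) (List.replicate P.L (c.dir, true)))
            * star ((corr (expMeanLogSU (n := n)) V c : Matrix.specialUnitaryGroup n ℂ) : Matrix n n ℂ))‖ ≤ 772 * m ^ 2 := by
  have hm0 : 0 ≤ m := (List.sum_nonneg fun y hy => by obtain ⟨z, _, rfl⟩ := List.mem_map.mp hy; exact norm_nonneg _).trans hmS
  have hmhalf : m ≤ 1 / 2 := by linarith
  -- (a) the ratio-currency remainder `‖R − T_VY(c)‖ ≤ 260m²` (★p1 g4)
  have hRT : ‖pertVar (avgFun (expMeanLogSU (n := n)) V) (avgFun (expMeanLogSU (n := n)) U) c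
      - (fderiv ℂ (eml : (Idx P → Matrix n n ℂ) → Matrix n n ℂ) (fun i => ((loopHol V c i : Matrix.specialUnitaryGroup n ℂ) : Matrix n n ℂ))
            (fun i => covWalkSum V (pertVar V U) (walk (emb c.src) (loopWord P.L c.dir (off i.1) i.2.1 i.2.2)) * ((loopHol V c i : Matrix.specialUnitaryGroup n ℂ) : Matrix n n ℂ))
            * star ((corr (expMeanLogSU (n := n)) V c : Matrix.specialUnitaryGroup n ℂ) : Matrix n n ℂ)
          + ((corr (expMeanLogSU (n := n)) V c : Matrix.specialUnitaryGroup n ℂ) : Matrix n n ℂ)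
            * covWalkSum V (pertVar V U) (walk (emb c.src) (List.replicate P.L (c.dir, true)))
            * star ((corr (expMeanLogSU (n := n)) V c : Matrix.specialUnitaryGroup n ℂ) : Matrix n n ℂ))‖ ≤ 260 * m ^ 2 := by
    rw [pertVar_eq]
    exact norm_avgFun_ratio_sub_one_sub_trueLin_le V U c hmL hmS hm72 hα hα24 hN
  -- (b) `‖T_VY(c)‖ ≤ 7m`
  have hTY : ‖(fderiv ℂ (eml : (Idx P → Matrix n n ℂ) → Matrix n n ℂ) (fun i => ((loopHol V c i : Matrix.specialUnitaryGroup n ℂ) : Matrix n n ℂ))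
            (fun i => covWalkSum V (pertVar V U) (walk (emb c.src) (loopWord P.L c.dir (off i.1) i.2.1 i.2.2)) * ((loopHol V c i : Matrix.specialUnitaryGroup n ℂ) : Matrix n n ℂ))
            * star ((corr (expMeanLogSU (n := n)) V c : Matrix.specialUnitaryGroup n ℂ) : Matrix n n ℂ)
          + ((corr (expMeanLogSU (n := n)) V c : Matrix.specialUnitaryGroup n ℂ) : Matrix n n ℂ)
            * covWalkSum V (pertVar V U) (walk (emb c.src) (List.replicate P.L (c.dir, true)))
            * star ((corr (expMeanLogSU (n := n)) V c : Matrix.specialUnitaryGroup n ℂ) : Matrix n n ℂ))‖ ≤ 7 * m := norm_trueLin_le_of_mass V (pertVar V U) c hmL hmS hα hα24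
  -- (c) the log letter along the walks: the walk masses of `X − Y` are `≤ 4m²`, hence `‖T_V(X − Y)(c)‖ ≤ 28m²`
  have hmL' : ∀ i : Idx P, ((walk (emb c.src) (loopWord P.L c.dir (off i.1) i.2.1 i.2.2)).map fun s => ‖((fun b => mlog (pertVar V U b + 1)) - pertVar V U) s.bond‖).sum ≤ 4 * m ^ 2 :=
    fun i => walk_mass_mlog_sub_le (pertVar V U) _ (hmL i) hmhalf
  have hmS' : ((walk (emb c.src) (List.replicate P.L (c.dir, true))).map fun s => ‖((fun b => mlog (pertVar V U b + 1)) - pertVar V U) s.bond‖).sum ≤ 4 * m ^ 2 :=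
    walk_mass_mlog_sub_le (pertVar V U) _ hmS hmhalf
  have hTXY : ‖(fderiv ℂ (eml : (Idx P → Matrix n n ℂ) → Matrix n n ℂ) (fun i => ((loopHol V c i : Matrix.specialUnitaryGroup n ℂ) : Matrix n n ℂ))
            (fun i => covWalkSum V ((fun b => mlog (pertVar V U b + 1)) - pertVar V U) (walk (emb c.src) (loopWord P.L c.dir (off i.1) i.2.1 i.2.2)) * ((loopHol V c i : Matrix.specialUnitaryGroup n ℂ) : Matrix n n ℂ))
            * star ((corr (expMeanLogSU (n := n)) V c : Matrix.specialUnitaryGroup n ℂ) : Matrix n n ℂ)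
          + ((corr (expMeanLogSU (n := n)) V c : Matrix.specialUnitaryGroup n ℂ) : Matrix n n ℂ)
            * covWalkSum V ((fun b => mlog (pertVar V U b + 1)) - pertVar V U) (walk (emb c.src) (List.replicate P.L (c.dir, true)))
            * star ((corr (expMeanLogSU (n := n)) V c : Matrix.specialUnitaryGroup n ℂ) : Matrix n n ℂ))‖ ≤ 7 * (4 * m ^ 2) :=
    norm_trueLin_le_of_mass V ((fun b => mlog (pertVar V U b + 1)) - pertVar V U) c hmL' hmS' hα hα24
  -- (d) assemble
  exact norm_sub_le_of_three_pieces _ _ _ _ _ hm0 hm72 hRT hTY (fun h => norm_mlog_add_one_sub_le h) hTXY (trueLin_sub V (fun b => mlog (pertVar V U b + 1)) (pertVar V U) c)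

/-! ## §3 ★★★ At level `j` of the towers: the `ℓ¹` source row against the `ℓ²` mass of the level ratio -/

section Towers

variable {N : ℕ} [NeZero N]

/-- ★★★ **THE PER-LEVEL SOURCE ROW OF THE LOG-CURRENCY ENGINE IN CRUDE MASS² CURRENCY** (file 2c's ∕ F2's displayed summand, letters VERBATIM).  `U₀, W ∈ SU(N)` on the
finest torus, level `j + 1 ≤ m + K`; `Y_j = pertVar Ū₀^{(j)} W̄^{(j)}` the level ratio, `X_j = mlog (Y_j + 1)`, `X_{j+1} = mlog (Y_{j+1} + 1)` the log-ratios, `T_j` the true one-step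
derivative at the background `Ū₀^{(j)}` (the `hQs` letters); the background's (0.4) loop variables at level `j` are within `a ≤ 1∕24` of `1`; ONE sup guard on the two-block
neighbourhood masses `(d+2)L·Σ_{b∈N(c)}‖Y_j b‖ ≤ μ` with `72μ ≤ 1`, `3μ + a < δ_N`.  Then
`Σ_c‖X_{j+1}(c) − T_jX_j(c)‖ ≤ 772·((d+2)L)²·(2dL^d)·(2d)·Σ_b‖Y_j b‖²` — the `hr : r_j ≤ C·M_j` input of F4 ✓∕⧗ `…Prop7JointRowOfLevelMasses` with the `ℓ²` level mass
`M_j = Σ_b‖Y_j b‖²` of ✓ `…Prop7FibreLevelMass` and the L-only constant `C = 772·((d+2)L)²·(2dL^d)·(2d)`.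
[cite: Balaban1985Averaging, Prop. 3 (122)-(126) p.36, (26)-(27) p.21; Balaban1987RG1, (0.3)-(0.4) pp.252-253] -/
theorem sum_norm_logRemainder_le_mass (U₀ W : GaugeField P 0 (Matrix.specialUnitaryGroup (Fin N) ℂ)) (j : ℕ) (hj : j + 1 ≤ P.m + P.K) {a μ : ℝ}
    (hα : ∀ (c : PBond P (j + 1)) (i : Idx P), dist1 (loopHol (Averaging.iter (fun i => blockAvg (P := P) (j := i) (expMeanLogSU (n := Fin N))) j U₀) c i) ≤ a) (ha24 : a ≤ 1 / 24)
    (hμ : ∀ c : PBond P (j + 1), (((P.d + 2) * P.L : ℕ) : ℝ) * ∑ b ∈ (univ.filter (fun b : PBond P j => blockOf b.src = c.src ∨ blockOf b.src = c.tgt)), ‖(pertVar (Averaging.iter (fun i => blockAvg (P := P) (j := i) (expMeanLogSU (n := Fin N))) j U₀) (Averaging.iter (fun i => blockAvg (P := P) (j := i) (expMeanLogSU (n := Fin N))) j W)) b‖ ≤ μ)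
    (hμ72 : 72 * μ ≤ 1) (hμN : 3 * μ + a < deltaSU (Fin N)) :
    ∑ c : PBond P (j + 1), ‖mlog (pertVar (Averaging.iter (fun i => blockAvg (P := P) (j := i) (expMeanLogSU (n := Fin N))) (j + 1) U₀) (Averaging.iter (fun i => blockAvg (P := P) (j := i) (expMeanLogSU (n := Fin N))) (j + 1) W) c + 1)
        - (fderiv ℂ (eml : (Idx P → Matrix (Fin N) (Fin N) ℂ) → Matrix (Fin N) (Fin N) ℂ) (fun i => ((loopHol (Averaging.iter (fun i => blockAvg (P := P) (j := i) (expMeanLogSU (n := Fin N))) j U₀) c i : Matrix.specialUnitaryGroup (Fin N) ℂ) : Matrix (Fin N) (Fin N) ℂ))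
            (fun i => covWalkSum (Averaging.iter (fun i => blockAvg (P := P) (j := i) (expMeanLogSU (n := Fin N))) j U₀) (fun b => mlog (pertVar (Averaging.iter (fun i => blockAvg (P := P) (j := i) (expMeanLogSU (n := Fin N))) j U₀) (Averaging.iter (fun i => blockAvg (P := P) (j := i) (expMeanLogSU (n := Fin N))) j W) b + 1)) (walk (emb c.src) (loopWord P.L c.dir (off i.1) i.2.1 i.2.2)) * ((loopHol (Averaging.iter (fun i => blockAvg (P := P) (j := i) (expMeanLogSU (n := Fin N))) j U₀) c i : Matrix.specialUnitaryGroup (Fin N) ℂ) : Matrix (Fin N) (Fin N) ℂ))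
            * star ((corr (expMeanLogSU (n := Fin N)) (Averaging.iter (fun i => blockAvg (P := P) (j := i) (expMeanLogSU (n := Fin N))) j U₀) c : Matrix.specialUnitaryGroup (Fin N) ℂ) : Matrix (Fin N) (Fin N) ℂ)
          + ((corr (expMeanLogSU (n := Fin N)) (Averaging.iter (fun i => blockAvg (P := P) (j := i) (expMeanLogSU (n := Fin N))) j U₀) c : Matrix.specialUnitaryGroup (Fin N) ℂ) : Matrix (Fin N) (Fin N) ℂ)
            * covWalkSum (Averaging.iter (fun i => blockAvg (P := P) (j := i) (expMeanLogSU (n := Fin N))) j U₀) (fun b => mlog (pertVar (Averaging.iter (fun i => blockAvg (P := P) (j := i) (expMeanLogSU (n := Fin N))) j U₀) (Averaging.iter (fun i => blockAvg (P := P) (j := i) (expMeanLogSU (n := Fin N))) j W) b + 1)) (walk (emb c.src) (List.replicate P.L (c.dir, true)))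
            * star ((corr (expMeanLogSU (n := Fin N)) (Averaging.iter (fun i => blockAvg (P := P) (j := i) (expMeanLogSU (n := Fin N))) j U₀) c : Matrix.specialUnitaryGroup (Fin N) ℂ) : Matrix (Fin N) (Fin N) ℂ))‖
      ≤ 772 * ((((P.d + 2) * P.L : ℕ) : ℝ) ^ 2 * (2 * P.d * (P.L : ℝ) ^ P.d) * (2 * P.d) * ∑ b : PBond P j, ‖(pertVar (Averaging.iter (fun i => blockAvg (P := P) (j := i) (expMeanLogSU (n := Fin N))) j U₀) (Averaging.iter (fun i => blockAvg (P := P) (j := i) (expMeanLogSU (n := Fin N))) j W)) b‖ ^ 2) := by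
  -- per coarse bond: §2 at the two-block neighbourhood mass `m(c) = (d+2)L·Σ_{N(c)}‖Y_j‖`
  have hpt : ∀ c : PBond P (j + 1), ‖mlog (pertVar (Averaging.iter (fun i => blockAvg (P := P) (j := i) (expMeanLogSU (n := Fin N))) (j + 1) U₀) (Averaging.iter (fun i => blockAvg (P := P) (j := i) (expMeanLogSU (n := Fin N))) (j + 1) W) c + 1)
        - (fderiv ℂ (eml : (Idx P → Matrix (Fin N) (Fin N) ℂ) → Matrix (Fin N) (Fin N) ℂ) (fun i => ((loopHol (Averaging.iter (fun i => blockAvg (P := P) (j := i) (expMeanLogSU (n := Fin N))) j U₀) c i : Matrix.specialUnitaryGroup (Fin N) ℂ) : Matrix (Fin N) (Fin N) ℂ))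
            (fun i => covWalkSum (Averaging.iter (fun i => blockAvg (P := P) (j := i) (expMeanLogSU (n := Fin N))) j U₀) (fun b => mlog (pertVar (Averaging.iter (fun i => blockAvg (P := P) (j := i) (expMeanLogSU (n := Fin N))) j U₀) (Averaging.iter (fun i => blockAvg (P := P) (j := i) (expMeanLogSU (n := Fin N))) j W) b + 1)) (walk (emb c.src) (loopWord P.L c.dir (off i.1) i.2.1 i.2.2)) * ((loopHol (Averaging.iter (fun i => blockAvg (P := P) (j := i) (expMeanLogSU (n := Fin N))) j U₀) c i : Matrix.specialUnitaryGroup (Fin N) ℂ) : Matrix (Fin N) (Fin N) ℂ))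
            * star ((corr (expMeanLogSU (n := Fin N)) (Averaging.iter (fun i => blockAvg (P := P) (j := i) (expMeanLogSU (n := Fin N))) j U₀) c : Matrix.specialUnitaryGroup (Fin N) ℂ) : Matrix (Fin N) (Fin N) ℂ)
          + ((corr (expMeanLogSU (n := Fin N)) (Averaging.iter (fun i => blockAvg (P := P) (j := i) (expMeanLogSU (n := Fin N))) j U₀) c : Matrix.specialUnitaryGroup (Fin N) ℂ) : Matrix (Fin N) (Fin N) ℂ)
            * covWalkSum (Averaging.iter (fun i => blockAvg (P := P) (j := i) (expMeanLogSU (n := Fin N))) j U₀) (fun b => mlog (pertVar (Averaging.iter (fun i => blockAvg (P := P) (j := i) (expMeanLogSU (n := Fin N))) j U₀) (Averaging.iter (fun i => blockAvg (P := P) (j := i) (expMeanLogSU (n := Fin N))) j W) b + 1)) (walk (emb c.src) (List.replicate P.L (c.dir, true)))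
            * star ((corr (expMeanLogSU (n := Fin N)) (Averaging.iter (fun i => blockAvg (P := P) (j := i) (expMeanLogSU (n := Fin N))) j U₀) c : Matrix.specialUnitaryGroup (Fin N) ℂ) : Matrix (Fin N) (Fin N) ℂ))‖
      ≤ 772 * ((((P.d + 2) * P.L : ℕ) : ℝ) * ∑ b ∈ (univ.filter (fun b : PBond P j => blockOf b.src = c.src ∨ blockOf b.src = c.tgt)), ‖(pertVar (Averaging.iter (fun i => blockAvg (P := P) (j := i) (expMeanLogSU (n := Fin N))) j U₀) (Averaging.iter (fun i => blockAvg (P := P) (j := i) (expMeanLogSU (n := Fin N))) j W)) b‖) ^ 2 := by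
    intro c
    have hm72 : 72 * ((((P.d + 2) * P.L : ℕ) : ℝ) * ∑ b ∈ (univ.filter (fun b : PBond P j => blockOf b.src = c.src ∨ blockOf b.src = c.tgt)), ‖(pertVar (Averaging.iter (fun i => blockAvg (P := P) (j := i) (expMeanLogSU (n := Fin N))) j U₀) (Averaging.iter (fun i => blockAvg (P := P) (j := i) (expMeanLogSU (n := Fin N))) j W)) b‖) ≤ 1 := by
      have h := hμ c; nlinarith
    have hN : 3 * ((((P.d + 2) * P.L : ℕ) : ℝ) * ∑ b ∈ (univ.filter (fun b : PBond P j => blockOf b.src = c.src ∨ blockOf b.src = c.tgt)), ‖(pertVar (Averaging.iter (fun i => blockAvg (P := P) (j := i) (expMeanLogSU (n := Fin N))) j U₀) (Averaging.iter (fun i => blockAvg (P := P) (j := i) (expMeanLogSU (n := Fin N))) j W)) b‖) + a < deltaSU (Fin N) := by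
      have h := hμ c; linarith
    exact norm_mlog_pertVar_avg_sub_trueLin_mlog_le (Averaging.iter (fun i => blockAvg (P := P) (j := i) (expMeanLogSU (n := Fin N))) j U₀) (Averaging.iter (fun i => blockAvg (P := P) (j := i) (expMeanLogSU (n := Fin N))) j W) c
      (fun i => mass_loop_le hj _ c i) (mass_segment_le hj _ c) hm72 (hα c) ha24 hN
  calc _ ≤ ∑ c : PBond P (j + 1), 772 * ((((P.d + 2) * P.L : ℕ) : ℝ) * ∑ b ∈ (univ.filter (fun b : PBond P j => blockOf b.src = c.src ∨ blockOf b.src = c.tgt)), ‖(pertVar (Averaging.iter (fun i => blockAvg (P := P) (j := i) (expMeanLogSU (n := Fin N))) j U₀) (Averaging.iter (fun i => blockAvg (P := P) (j := i) (expMeanLogSU (n := Fin N))) j W)) b‖) ^ 2 := Finset.sum_le_sum fun c _ => hpt c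
    _ = 772 * ∑ c : PBond P (j + 1), ((((P.d + 2) * P.L : ℕ) : ℝ) * ∑ b ∈ (univ.filter (fun b : PBond P j => blockOf b.src = c.src ∨ blockOf b.src = c.tgt)), ‖(pertVar (Averaging.iter (fun i => blockAvg (P := P) (j := i) (expMeanLogSU (n := Fin N))) j U₀) (Averaging.iter (fun i => blockAvg (P := P) (j := i) (expMeanLogSU (n := Fin N))) j W)) b‖) ^ 2 := by rw [Finset.mul_sum]
    _ ≤ 772 * ((((P.d + 2) * P.L : ℕ) : ℝ) ^ 2 * (2 * P.d * (P.L : ℝ) ^ P.d) * (2 * P.d) * ∑ b : PBond P j, ‖(pertVar (Averaging.iter (fun i => blockAvg (P := P) (j := i) (expMeanLogSU (n := Fin N))) j U₀) (Averaging.iter (fun i => blockAvg (P := P) (j := i) (expMeanLogSU (n := Fin N))) j W)) b‖ ^ 2) :=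
        mul_le_mul_of_nonneg_left (sum_sq_nbhdMass_le hj _) (by norm_num)

end Towers

end Summit.QuantumFields.YangMills.Theorems.Prop7LogRemainderMass
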